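import Literature.Analysis.FluidPDE.LerayProfileWeakPressure
import Literature.Analysis.FunctionSpaces.SobolevLocal
import HarnessLib

/-!
# Regularity of Leray profiles: the `H^s`-bootstrap (Tsai 1998, p. 33)

Analysis/FluidPDE support file (seventh of the chain discharging the named fact
`Literature.Analysis.FluidPDE.tsai1998_profile_smooth`; the one-line discharge
`tsai1998_profile_smooth_holds` is in `TsaiGrowthLemmasProofs`). T.-P. Tsai, ARMA 143 (1998),
p. 33: "By standard regularity theory of stationary Navier–Stokes equations, every weak
solution `U` of (1.3) is actually smooth (see, for example, [Ga II, GiM, La, Te])" — no proof is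
printed; this file supplies the standard `L²`-Sobolev bootstrap (Folland, *Introduction to
PDE*, 2nd ed., Ch. 6) for the tree's pointwise profile class `IsLerayProfile ν a U P`
(`U ∈ C²`, `P ∈ C¹`) on `ℝ^ι`, `|ι| ≤ 3`, `ν ≠ 0`:

* `IsLerayProfile.locallyHs_velocity_pressure` — for every `k`, `Uᵢ ∈ H^{k+2}_loc` and
  `P ∈ H^{k+1}_loc` (complexified components, `LocallyHs` of `SobolevLocal`). Induction on `k`:
  `∂ⱼUᵢ ∈ H^{k+1}_loc`; the quadratic terms `Σ∂ᵢUⱼ∂ⱼUᵢ`, `Σⱼ Uⱼ∂ⱼUᵢ`, `Σⱼ yⱼ∂ⱼUᵢ` are in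
  `H^{k+1}_loc` (classically for `k = 0`, where they are `C¹`; by the product law
  `LocallyHs.mul`, `|ι| ≤ 3 < 2(k+1)`, for `k ≥ 1`); the weak pressure–Poisson equation
  `ΔP = -Σ∂ᵢUⱼ∂ⱼUᵢ` (`LerayProfileWeakPressure`) and local elliptic regularity
  (`LocallyHs.of_weakLaplacian`, twice) give `P ∈ H^{k+3}_loc`, hence `∂ᵢP ∈ H^{k+2}_loc`; the
  profile equation `ΔUᵢ = ν⁻¹(∂ᵢP + aUᵢ + aΣⱼyⱼ∂ⱼUᵢ + ΣⱼUⱼ∂ⱼUᵢ) ∈ H^{k+1}_loc` and local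
  elliptic regularity give `Uᵢ ∈ H^{k+3}_loc`.
* `IsLerayProfile.contDiff_velocity_infty` — **`U ∈ C^∞`** (the local Sobolev lemma
  `LocallyHs.contDiff`: `H^{k+2}_loc ∩ C⁰ ⊂ C^k` as `|ι| < 4`, for every `k`).

## References

* T.-P. Tsai, ARMA 143 (1998) 29–51, p. 33, (1.3), (2.1). [Tsai1998]
* G. B. Folland, *Introduction to Partial Differential Equations*, 2nd ed. (1995), §6.A
  (Theorem (6.5), Exercise 4), §6.C (Theorem (6.33), Corollary (6.34)). [Folland1995PDE]
-/

noncomputable section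

open MeasureTheory
open scoped ENNReal ContDiff

namespace Literature.Analysis.FluidPDE

open Literature.Analysis.FunctionSpaces

variable {ι : Type*} [Fintype ι] [DecidableEq ι]

/-- Local notation for the Euclidean space `ℝ^ι`. -/
local notation "𝔼" => EuclideanSpace ℝ ι

/-! ### The bootstrap -/

/-- **The Sobolev bootstrap for Leray profiles** (Tsai 1998, p. 33, "standard regularity
theory"; Folland, *Introduction to PDE*, proof of Theorem (6.33)/(6.34) adapted to the profile
system): for a Leray profile on `ℝ^ι`, `|ι| ≤ 3`, `ν ≠ 0`, and every `k : ℕ`, the complexified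
velocity components are in `H^{k+2}_loc` and the pressure is in `H^{k+1}_loc`.
[cite: Tsai1998, p. 33] -/
theorem IsLerayProfile.locallyHs_velocity_pressure {ν a : ℝ} {U : 𝔼 → 𝔼} {P : 𝔼 → ℝ}
    (h : IsLerayProfile ν a U P) (hν : ν ≠ 0) (hι : Fintype.card ι ≤ 3) (k : ℕ) :
    (∀ i, LocallyHs ((k : ℝ) + 2) (fun x => (U x i : ℂ))) ∧
      LocallyHs ((k : ℝ) + 1) (fun x => (P x : ℂ)) := by
  set b := EuclideanSpace.basisFun ι ℝ with hbdef
  have hd : (Module.finrank ℝ 𝔼 : ℝ) ≤ 3 := by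
    rw [finrank_euclideanSpace]
    exact_mod_cast hι
  -- regularity bookkeeping
  have hUc : ∀ i, ContDiff ℝ 2 (fun z => U z i) := fun i =>
    contDiff_comp_euclidean h.contDiff_velocity i
  have hU1 : ∀ i, ContDiff ℝ 1 (fun z => U z i) := fun i => (hUc i).of_le (by norm_num)
  have hUd : ∀ i, Differentiable ℝ (fun z => U z i) := fun i => (hU1 i).differentiable one_ne_zero
  have hd1 : ∀ i j, ContDiff ℝ 1 (pderiv j fun z => U z i) := fun i j =>
    contDiff_one_pderiv_of_contDiff_two (hUc i) j
  have hdd : ∀ i j, Differentiable ℝ (pderiv j fun z => U z i) := fun i j =>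
    (hd1 i j).differentiable one_ne_zero
  have hP1 : ContDiff ℝ 1 P := h.contDiff_pressure
  have hPd : Differentiable ℝ P := hP1.differentiable one_ne_zero
  -- complexified objects
  set Uc : ι → 𝔼 → ℂ := fun i x => (U x i : ℂ) with hUcdef
  set Pc : 𝔼 → ℂ := fun x => (P x : ℂ) with hPcdef
  set dU : ι → ι → 𝔼 → ℂ := fun i j x => (pderiv j (fun z => U z i) x : ℂ) with hdUdef
  set dP : ι → 𝔼 → ℂ := fun i x => (pderiv i P x : ℂ) with hdPdef
  set N₁ : ι → 𝔼 → ℂ := fun i x => ∑ j, Uc j x * dU i j x with hN₁def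
  set N₂ : ι → 𝔼 → ℂ := fun i x => ∑ j, ((x j : ℝ) : ℂ) * dU i j x with hN₂def
  set q : 𝔼 → ℂ := fun x =>
    ((-(∑ i, ∑ j, pderiv i (fun z => U z j) x * pderiv j (fun z => U z i) x) : ℝ) : ℂ) with hqdef
  set L : ι → 𝔼 → ℂ := fun i x => ∑ j, fderiv ℝ (fun y => fderiv ℝ (Uc i) y (b j)) x (b j)
    with hLdef
  have hUc2 : ∀ i, ContDiff ℝ 2 (Uc i) := fun i => contDiff_ofReal_comp (hUc i)
  have hUc1 : ∀ i, ContDiff ℝ 1 (Uc i) := fun i => contDiff_ofReal_comp (hU1 i)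
  have hPc1 : ContDiff ℝ 1 Pc := contDiff_ofReal_comp hP1
  have hdU1 : ∀ i j, ContDiff ℝ 1 (dU i j) := fun i j => contDiff_ofReal_comp (hd1 i j)
  have hdPc : ∀ i, Continuous (dP i) := fun i =>
    Complex.continuous_ofReal.comp (continuous_pderiv hP1 one_ne_zero i)
  have hcoordc : ∀ j, ContDiff ℝ ∞ (fun x : 𝔼 => ((x j : ℝ) : ℂ)) := fun j =>
    contDiff_ofReal_comp (contDiff_euclideanCoord j)
  have hN₁1 : ∀ i, ContDiff ℝ 1 (N₁ i) := fun i =>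
    ContDiff.sum fun j _ => (hUc1 j).mul (hdU1 i j)
  have hN₂1 : ∀ i, ContDiff ℝ 1 (N₂ i) := fun i =>
    ContDiff.sum fun j _ => ((hcoordc j).of_le (by exact_mod_cast le_top)).mul (hdU1 i j)
  have hqeq : q = fun x => -∑ i, ∑ j, dU j i x * dU i j x := by
    funext x
    simp only [hqdef, hdUdef]
    push_cast
    rfl
  have hq1 : ContDiff ℝ 1 q := by
    rw [hqeq]
    exact (ContDiff.sum fun i _ => ContDiff.sum fun j _ => (hdU1 j i).mul (hdU1 i j)).neg
  -- derivatives of the complexified functions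
  have hfdU : ∀ i j, (fun x => fderiv ℝ (Uc i) x (b j)) = dU i j := fun i j => by
    rw [hbdef]
    exact fderiv_ofReal_comp_stdVec (hUd i) j
  have hfdP : ∀ i, (fun x => fderiv ℝ Pc x (b i)) = dP i := fun i => by
    rw [hbdef]
    exact fderiv_ofReal_comp_stdVec hPd i
  have hLeq' : ∀ i x, L i x = ((∑ j, pderiv j (pderiv j fun z => U z i) x : ℝ) : ℂ) := by
    intro i x
    simp only [hLdef, hfdU]
    push_cast
    refine Finset.sum_congr rfl fun j _ => ?_
    have := congrFun (fderiv_ofReal_comp_stdVec (hdd i j) j) x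
    simpa only [hbdef] using this
  have hLc' : ∀ i, Continuous (L i) := fun i => by
    rw [show L i = fun x => ((∑ j, pderiv j (pderiv j fun z => U z i) x : ℝ) : ℂ) from
      funext (hLeq' i)]
    exact Complex.continuous_ofReal.comp
      (continuous_finsetSum _ fun j _ => continuous_pderiv (hd1 i j) one_ne_zero j)
  -- the profile equation solved for the Laplacian
  have hLeq : ∀ i, L i = fun x => (ν⁻¹ : ℂ) * (dP i x + (a * Uc i x + (a * N₂ i x + N₁ i x))) := by
    intro i
    funext x
    rw [hLeq' i x]
    have hpc := h.profile_comp x i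
    have e : ∑ j, pderiv j (pderiv j fun z => U z i) x =
        ν⁻¹ * (pderiv i P x + (a * U x i + (a * ∑ j, x j * pderiv j (fun z => U z i) x +
          ∑ j, U x j * pderiv j (fun z => U z i) x))) := by
      field_simp
      linarith
    rw [e]
    simp only [hdPdef, hUcdef, hN₂def, hN₁def, hdUdef]
    push_cast
    ring
  -- the weak equations
  have hPq : ∀ ψ : 𝔼 → ℂ, ContDiff ℝ ∞ ψ → HasCompactSupport ψ →
      ∫ x, Pc x * ∑ i, fderiv ℝ (fun y => fderiv ℝ ψ y (b i)) x (b i) = ∫ x, q x * ψ x :=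
    fun ψ hψ hψs => h.integral_pressure_mul_laplacian ψ hψ hψs
  have hUL : ∀ i, ∀ ψ : 𝔼 → ℂ, ContDiff ℝ ∞ ψ → HasCompactSupport ψ →
      ∫ x, Uc i x * ∑ j, fderiv ℝ (fun y => fderiv ℝ ψ y (b j)) x (b j) = ∫ x, L i x * ψ x :=
    fun i ψ hψ hψs => integral_mul_sum_fderiv_fderiv b (hUc2 i) ψ hψ hψs
  -- products one level up, with the `k = 0` case done classically
  have hprod : ∀ (k : ℕ) {f g : 𝔼 → ℂ}, ContDiff ℝ 1 f → ContDiff ℝ 1 g →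
      LocallyHs ((k : ℝ) + 1) f → LocallyHs ((k : ℝ) + 1) g →
      LocallyHs ((k : ℝ) + 1) (fun x => f x * g x) := by
    intro k f g hf hg hfl hgl
    rcases Nat.eq_zero_or_pos k with hk | hk
    · subst hk
      have := locallyHs_of_contDiff (hf.mul hg)
      simpa using this
    · refine hfl.mul ?_ hf.continuous hg.continuous hgl
      have : (1 : ℝ) ≤ k := by exact_mod_cast hk
      linarith
  -- the induction
  induction k with
  | zero =>
    refine ⟨fun i => ?_, ?_⟩
    · have := locallyHs_of_contDiff (hUc2 i)
      norm_num
      exact_mod_cast this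
    · have := locallyHs_of_contDiff hPc1
      norm_num
      exact_mod_cast this
  | succ k ih =>
    obtain ⟨HU, HP⟩ := ih
    -- (a) first derivatives of `U`
    have HdU : ∀ i j, LocallyHs ((k : ℝ) + 1) (dU i j) := fun i j => by
      have := (HU i).fderiv_apply (hUc1 i) (b j)
      rw [hfdU i j] at this
      have e : (k : ℝ) + 2 - 1 = k + 1 := by ring
      rwa [e] at this
    -- (b) the quadratic terms
    have Hq : LocallyHs ((k : ℝ) + 1) q := by
      rw [hqeq]
      refine LocallyHs.neg (continuous_finsetSum _ fun i _ => continuous_finsetSum _ fun j _ =>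
        ((hdU1 j i).mul (hdU1 i j)).continuous) ?_
      refine LocallyHs.finset_sum _ (fun i => continuous_finsetSum _ fun j _ =>
        ((hdU1 j i).mul (hdU1 i j)).continuous) fun i => ?_
      exact LocallyHs.finset_sum _ (fun j => ((hdU1 j i).mul (hdU1 i j)).continuous) fun j =>
        hprod k (hdU1 j i) (hdU1 i j) (HdU j i) (HdU i j)
    have HN₁ : ∀ i, LocallyHs ((k : ℝ) + 1) (N₁ i) := fun i =>
      LocallyHs.finset_sum _ (fun j => ((hUc1 j).mul (hdU1 i j)).continuous) fun j =>
        hprod k (hUc1 j) (hdU1 i j) ((HU j).mono (by linarith)) (HdU i j)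
    have HN₂ : ∀ i, LocallyHs ((k : ℝ) + 1) (N₂ i) := fun i =>
      LocallyHs.finset_sum _ (fun j => (((hcoordc j).of_le (by exact_mod_cast le_top)).mul
        (hdU1 i j)).continuous) fun j =>
        hprod k ((hcoordc j).of_le (by exact_mod_cast le_top)) (hdU1 i j)
          (locallyHs_of_contDiff_infty (hcoordc j) _) (HdU i j)
    -- (c) the pressure, twice
    have HP2 : LocallyHs ((k : ℝ) + 2) Pc := by
      refine LocallyHs.of_weakLaplacian b hPc1 hq1.continuous hPq ?_ ?_
      · have e : (k : ℝ) + 2 - 1 = k + 1 := by ring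
        rw [e]; exact HP
      · have e : (k : ℝ) + 2 - 2 = k := by ring
        rw [e]; exact Hq.mono (by linarith)
    have HP3 : LocallyHs ((k : ℝ) + 3) Pc := by
      refine LocallyHs.of_weakLaplacian b hPc1 hq1.continuous hPq ?_ ?_
      · have e : (k : ℝ) + 3 - 1 = k + 2 := by ring
        rw [e]; exact HP2
      · have e : (k : ℝ) + 3 - 2 = k + 1 := by ring
        rw [e]; exact Hq
    -- (d) the pressure gradient
    have HdP : ∀ i, LocallyHs ((k : ℝ) + 2) (dP i) := fun i => by
      have := HP3.fderiv_apply hPc1 (b i)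
      rw [hfdP i] at this
      have e : (k : ℝ) + 3 - 1 = k + 2 := by ring
      rwa [e] at this
    -- (e) the Laplacian of `U`
    have HL : ∀ i, LocallyHs ((k : ℝ) + 1) (L i) := fun i => by
      rw [hLeq i]
      refine LocallyHs.const_mul ?_ ?_ _
      · exact (hdPc i).add ((continuous_const.mul (hUc1 i).continuous).add
          ((continuous_const.mul (hN₂1 i).continuous).add (hN₁1 i).continuous))
      refine ((HdP i).mono (by linarith)).add (hdPc i) ?_ ?_
      · exact (continuous_const.mul (hUc1 i).continuous).add
          ((continuous_const.mul (hN₂1 i).continuous).add (hN₁1 i).continuous)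
      refine (((HU i).mono (by linarith)).const_mul (hUc1 i).continuous _).add
        (continuous_const.mul (hUc1 i).continuous) ?_ ?_
      · exact (continuous_const.mul (hN₂1 i).continuous).add (hN₁1 i).continuous
      exact ((HN₂ i).const_mul (hN₂1 i).continuous _).add
        (continuous_const.mul (hN₂1 i).continuous) (hN₁1 i).continuous (HN₁ i)
    -- (f) the velocity
    have HU3 : ∀ i, LocallyHs ((k : ℝ) + 3) (Uc i) := fun i => by
      refine LocallyHs.of_weakLaplacian b (hUc1 i) (hLc' i) (hUL i) ?_ ?_
      · have e : (k : ℝ) + 3 - 1 = k + 2 := by ring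
        rw [e]; exact HU i
      · have e : (k : ℝ) + 3 - 2 = k + 1 := by ring
        rw [e]; exact HL i
    refine ⟨fun i => ?_, ?_⟩
    · have e : ((k + 1 : ℕ) : ℝ) + 2 = k + 3 := by push_cast; ring
      rw [e]; exact HU3 i
    · have e : ((k + 1 : ℕ) : ℝ) + 1 = k + 2 := by push_cast; ring
      rw [e]; exact HP2

/-- **Leray profiles are smooth** (Tsai 1998, p. 33: "every weak solution `U` of (1.3) is
actually smooth"), for the tree's pointwise profile class in dimension `|ι| ≤ 3` with `ν ≠ 0`:
`U ∈ C^∞` (from `Uᵢ ∈ H^{k+2}_loc` for all `k` and the local Sobolev lemma; Folland,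
Corollary (6.34)). [cite: Tsai1998, p. 33] -/
theorem IsLerayProfile.contDiff_velocity_infty {ν a : ℝ} {U : 𝔼 → 𝔼} {P : 𝔼 → ℝ}
    (h : IsLerayProfile ν a U P) (hν : ν ≠ 0) (hι : Fintype.card ι ≤ 3) : ContDiff ℝ ∞ U := by
  rw [contDiff_infty]
  intro n
  rw [contDiff_euclidean]
  intro i
  have HU := (h.locallyHs_velocity_pressure hν hι n).1 i
  have hd : (Module.finrank ℝ 𝔼 : ℝ) < 2 * (((n : ℝ) + 2) - n) := by
    rw [finrank_euclideanSpace]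
    have : (Fintype.card ι : ℝ) ≤ 3 := by exact_mod_cast hι
    linarith
  have hc : ContDiff ℝ n (fun x => (U x i : ℂ)) :=
    HU.contDiff hd (Complex.continuous_ofReal.comp (contDiff_comp_euclidean h.contDiff_velocity i
      |>.continuous))
  have e : (fun x => U x i) = fun x => Complex.re ((U x i : ℂ)) := by
    funext x; simp
  rw [e]
  exact Complex.reCLM.contDiff.comp hc

end Literature.Analysis.FluidPDE
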